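import Summits.AtomisticToContinuum.FouriersLaw.Theses.LogConcaveRigidity
import Summits.AtomisticToContinuum.FouriersLaw.Theorems.ParityLiouvilleSeedWindowLimit

/-!
# `Lines/birth.lean` — birth skeleton for the crux `LogConcaveRigidity.LogConcaveWindowLimit`
(crux item stmt-AtomisticToContinuum-16562, rank 9, glue-crux; route `route-AtomisticToContinuum-LogConcaveRigidity`;
skeleton-register, planner one-shot)

Crux (FIXED, concluded BY NAME): `LogConcaveWindowLimit` — BULK-WINDOW COMPACTNESS INSIDE THE BORELL
LOG-CONCAVE CLASS: for any real parameters `ω₂ lam β γ T_L T_R` and any family `μ_N` of weak steady states of the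
`N`-site pinned chain with site-uniform moments of all orders whose finite-`N` window laws ALL satisfy Borell's
multiplicative Brunn–Minkowski inequality `m(A)^θ · m(B)^(1-θ) ≤ m(θA + (1-θ)B)` (Borel `A, B`, `0 < θ < 1`), if
`ε ≤ |totalCurrent(μ_N)/(N-1)|` frequently then some probability measure `ν` on `(ℝ × ℝ)^ℤ` is time invariant,
translation bounded, has ALL box marginals Borell-log-concave, `j₀ ∈ L¹(ν)` and `ε ≤ |∫ j₀ dν|`.

THE SEAM. Everything except the log-concavity of the limit is the PROVED twin `windowLimit_proof`
(`ParityLiouvilleSeed.WindowLimit`, stmt-13982) and is invoked from the tree inside the glue: all bulk bond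
currents of a steady state agree (`centre_current_lower_bound`), Prokhorov extraction of the centred window laws
(`exists_weak_limit`), stationarity transfer (`isTimeInvariant_window_limit`), translation-boundedness
(`moments_of_window_limit`) and the limiting centre current (`current_of_window_limit`). The identification of
every box marginal of the limit as a weak limit of finite-`N` window laws of the family is PROVED here
(`windowLaws_tendsto_boxMarginal`, the bookkeeping `boxRestrictAt ∘ embed = windowMap`). What is NEW — Borell's
weak closedness of the log-concave class on the box space `Fin (n+1) → ℝ × ℝ` — is cut along the seam of Borell's
own proof (Borell 1975 Thm 2.1; the two risks named in the crux's why-it-might-fail):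

* **S1 `stub_borell_compact_of_tendsto` (WEAK-LIMIT STEP ON COMPACT PAIRS).** If probability measures `P_j → P₀`
  weakly on the box space and every `P_j` satisfies Borell's inequality on Borel pairs, then `P₀` satisfies it on
  COMPACT pairs `A, B`: `θA + (1-θ)B` is compact; `δ`-thickenings `U_i ⊇ A, B` are open with
  `θU₁ + (1-θ)U₂ ⊆ cthickening δ (θA + (1-θ)B)` (sup norm); portmanteau twice (`liminf` on the open `U_i`,
  `limsup` on the closed thickening), then `δ ↓ 0` by continuity from above of the finite measure `P₀`.
* **S2 `stub_borell_of_compact` (INNER-REGULARITY STEP).** A finite measure on the box space satisfying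
  Borell's inequality on compact pairs satisfies it on all Borel pairs: inner regularity w.r.t. compact sets
  (finite Borel measure on a Polish space), monotonicity of the outer measure of the Minkowski combination, and
  `t ↦ t^θ`, `t ↦ t^(1-θ)` monotone and continuous on `ℝ≥0∞` (`0 < θ < 1`).

GLUE `LogConcaveWindowLimit_of : LogConcaveWindowLimit` (real proof, its own body sorry-free; house style of
the registered lines of this sub-problem: hypothesis-free, the two stubs used BY NAME, so `sorryAx` enters only
through them). Exactness of the cut: neither stub alone is the crux (S1: compact pairs and an abstract weakly
convergent sequence; S2: one fixed finite measure) nor the summit `FouriersLaw` (BC3 probes, NOTES.md).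
Disproof.lean: none exists for this crux (`ledger crux ls`: no workfiles) — nothing to honour; no landed
`Theorems/LogConcaveWindowLimit/Negative/*`.
-/

noncomputable section

namespace Summit.AtomisticToContinuum.FouriersLaw.Cruxes.LogConcaveWindowLimit.Birth

open MeasureTheory Filter Topology Set
open Literature.MathematicalPhysics.KineticTheory.HeatConduction
open Summit.AtomisticToContinuum.FouriersLaw.Theses.LogConcaveRigidity (LogConcaveWindowLimit)
open Summit.AtomisticToContinuum.FouriersLaw.Theorems.WindowLimit

set_option linter.unusedVariables false

/-! ## S1 — Borell's inequality on compact pairs passes to weak limits -/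

/-- **S1 `stub_borell_compact_of_tendsto`** (size M; Borell 1975 Thm 2.1, weak-limit half). On the box space
`Fin (n+1) → ℝ × ℝ`: if `P j → P₀` weakly (topology of `MeasureTheory.ProbabilityMeasure`) and every `P j`
satisfies the multiplicative Brunn–Minkowski inequality `P(A)^θ P(B)^(1-θ) ≤ P(θA + (1-θ)B)` for all Borel
`A, B` and `0 < θ < 1`, then `P₀` satisfies it for all COMPACT `A, B`. Tools: `θA + (1-θ)B` compact (continuous
image of `A ×ˢ B`); open `δ`-thickenings `U₁ ⊇ A`, `U₂ ⊇ B` with `θU₁ + (1-θ)U₂ ⊆ Metric.cthickening δ (θA+(1-θ)B)`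
(the sup distance is a norm distance); portmanteau (`ProbabilityMeasure.le_liminf_measure_open_of_tendsto`,
`ProbabilityMeasure.limsup_measure_closed_le_of_tendsto`); `δ ↓ 0` via `tendsto_measure_cthickening_of_isCompact`;
`ENNReal.rpow` monotone/continuous for positive exponents. Why it might fail: only bookkeeping (liminf of a
product vs product of liminfs in `ℝ≥0∞`). -/
theorem stub_borell_compact_of_tendsto {n : ℕ}
    (P : ℕ → ProbabilityMeasure (Fin (n + 1) → ℝ × ℝ)) (P₀ : ProbabilityMeasure (Fin (n + 1) → ℝ × ℝ))
    (hlim : Tendsto P atTop (𝓝 P₀))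
    (hP : ∀ (j : ℕ) (A B : Set (Fin (n + 1) → ℝ × ℝ)) (θ : ℝ), MeasurableSet A → MeasurableSet B →
      0 < θ → θ < 1 →
      (P j : Measure (Fin (n + 1) → ℝ × ℝ)) A ^ θ * (P j : Measure (Fin (n + 1) → ℝ × ℝ)) B ^ (1 - θ) ≤
        (P j : Measure (Fin (n + 1) → ℝ × ℝ)) {z | ∃ x ∈ A, ∃ y ∈ B, z = θ • x + (1 - θ) • y}) :
    ∀ (A B : Set (Fin (n + 1) → ℝ × ℝ)) (θ : ℝ), IsCompact A → IsCompact B → 0 < θ → θ < 1 →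
      (P₀ : Measure (Fin (n + 1) → ℝ × ℝ)) A ^ θ * (P₀ : Measure (Fin (n + 1) → ℝ × ℝ)) B ^ (1 - θ) ≤
        (P₀ : Measure (Fin (n + 1) → ℝ × ℝ)) {z | ∃ x ∈ A, ∃ y ∈ B, z = θ • x + (1 - θ) • y} := by
  sorry

/-! ## S2 — from compact pairs to all Borel pairs (inner regularity) -/

/-- **S2 `stub_borell_of_compact`** (size S–M; Borell 1975 Thm 2.1, regularity half). A finite measure `m` on
the box space `Fin (n+1) → ℝ × ℝ` that satisfies the multiplicative Brunn–Minkowski inequality on all COMPACT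
pairs satisfies it on all Borel pairs: `m` is inner regular w.r.t. compact sets (finite Borel measure on a Polish /
σ-compact space: `MeasurableSet.measure_eq_iSup_isCompact_of_ne_top`), the Minkowski combination is monotone in
`(A, B)` and `m` (an outer measure) is monotone on arbitrary sets, and `t ↦ t^θ`, `t ↦ t^(1-θ)` are monotone and
continuous on `ℝ≥0∞` for `0 < θ < 1` (`ENNReal.monotone_rpow_of_nonneg`, `ENNReal.continuous_rpow_const`), so the
`iSup` over compact `K₁ ⊆ A`, `K₂ ⊆ B` passes through the left-hand side. Why it might fail: only bookkeeping
(`iSup` of a product of two independent suprema in `ℝ≥0∞`). -/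
theorem stub_borell_of_compact {n : ℕ} (m : Measure (Fin (n + 1) → ℝ × ℝ)) [IsFiniteMeasure m]
    (hK : ∀ (A B : Set (Fin (n + 1) → ℝ × ℝ)) (θ : ℝ), IsCompact A → IsCompact B → 0 < θ → θ < 1 →
      m A ^ θ * m B ^ (1 - θ) ≤ m {z | ∃ x ∈ A, ∃ y ∈ B, z = θ • x + (1 - θ) • y}) :
    ∀ (A B : Set (Fin (n + 1) → ℝ × ℝ)) (θ : ℝ), MeasurableSet A → MeasurableSet B → 0 < θ → θ < 1 →
      m A ^ θ * m B ^ (1 - θ) ≤ m {z | ∃ x ∈ A, ∃ y ∈ B, z = θ • x + (1 - θ) • y} := by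
  sorry

/-! ## Glue -/

variable {ω₂ lam β γ T_L T_R : ℝ}

/-- **Every box marginal of a window limit is a weak limit of finite-`N` window laws of the family** (proved
bookkeeping; the pattern of `klDiv_boxMarginal_window_limit_le`): if the centred window laws of `μ (Nk k)`
(`Nk → ∞`) converge weakly to `ν`, then for every box `{a, …, a+n}` of `ℤ` there are probability measures
`ρs k → ρ` weakly on `Fin (n+1) → ℝ × ℝ` with `ρ = boxMarginal a n ν` and each `ρs k` literally a window law
`(μ N).map (window a' … a'+n)` of some member of the family over a box inside the chain. [folklore] -/
theorem windowLaws_tendsto_boxMarginal (μ : (N : ℕ) → Measure (PhaseSpace N))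
    (hprob : ∀ N, IsProbabilityMeasure (μ N)) {Nk : ℕ → ℕ} (hNk : Tendsto Nk atTop atTop)
    {ν : Measure ChainConfig} [IsProbabilityMeasure ν]
    (hlim : Tendsto (fun k => (haveI := hprob (Nk k); windowPM (μ (Nk k)))) atTop (𝓝 (toPM ν)))
    (a : ℤ) (n : ℕ) :
    ∃ (ρs : ℕ → ProbabilityMeasure (Fin (n + 1) → ℝ × ℝ)) (ρ : ProbabilityMeasure (Fin (n + 1) → ℝ × ℝ)),
      (ρ : Measure (Fin (n + 1) → ℝ × ℝ)) = boxMarginal a n ν ∧ Tendsto ρs atTop (𝓝 ρ) ∧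
      ∀ k, ∃ (N a' : ℕ) (h : a' + (n + 1) ≤ N),
        (ρs k : Measure (Fin (n + 1) → ℝ × ℝ)) = (μ N).map (fun x => fun i : Fin (n + 1) =>
          (x.1 (Fin.castLE h (Fin.natAdd a' i)), x.2 (Fin.castLE h (Fin.natAdd a' i)))) := by
  have hbox : Continuous (boxRestrictAt a n) := continuous_pi fun i => continuous_apply _
  -- eventually the box `a + Nk k / 2, …` lies inside the chain
  obtain ⟨K₀, hK₀⟩ := eventually_atTop.1 (hNk.eventually_ge_atTop (2 * (a.natAbs + n + 2)))
  -- the shifted sequence of box marginals converges weakly to the box marginal of `ν`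
  set ρs : ℕ → ProbabilityMeasure (Fin (n + 1) → ℝ × ℝ) := fun k =>
    (haveI := hprob (Nk (k + K₀)); windowPM (μ (Nk (k + K₀)))).map hbox.measurable.aemeasurable with hρs
  set ρ : ProbabilityMeasure (Fin (n + 1) → ℝ × ℝ) := (toPM ν).map hbox.measurable.aemeasurable with hρ
  have hlim' : Tendsto (fun k => (haveI := hprob (Nk (k + K₀)); windowPM (μ (Nk (k + K₀))))) atTop
      (𝓝 (toPM ν)) := hlim.comp (tendsto_add_atTop_nat K₀)
  have hconv : Tendsto ρs atTop (𝓝 ρ) :=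
    ProbabilityMeasure.tendsto_map_of_tendsto_of_continuous _ _ hlim' hbox
  have hρeq : (ρ : Measure (Fin (n + 1) → ℝ × ℝ)) = boxMarginal a n ν := by
    rw [hρ, ProbabilityMeasure.toMeasure_map, coe_toPM]; rfl
  refine ⟨ρs, ρ, hρeq, hconv, fun k => ?_⟩
  -- the `k`-th term is a window law of a member of the family over a box inside the chain
  have hk : 2 * (a.natAbs + n + 2) ≤ Nk (k + K₀) := hK₀ _ (Nat.le_add_left _ _)
  set N := Nk (k + K₀) with hN
  haveI := hprob N
  have hc0 : 0 ≤ a + (N / 2 : ℕ) := by push_cast; omega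
  set a' : ℕ := (a + (N / 2 : ℕ)).toNat with ha'
  have ha'eq : a + (N / 2 : ℕ) = (a' : ℤ) := by rw [ha', Int.toNat_of_nonneg hc0]
  have h : a' + (n + 1) ≤ N := by omega
  refine ⟨N, a', h, ?_⟩
  rw [hρs, ProbabilityMeasure.toMeasure_map, coe_windowPM,
    Measure.map_map (boxRestrictAt_measurable a n) (measurable_embed _ _)]
  congr 1
  funext x
  exact boxRestrictAt_embed N (N / 2) ha'eq h x

/-- **The kernel-checked composition**: the proved window-limit machinery of the twin `windowLimit_proof`
(invoked from the tree), the proved identification `windowLaws_tendsto_boxMarginal`, and the two stubs S1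
(weak-limit step on compact pairs) and S2 (inner-regularity step) give the crux `LogConcaveWindowLimit` BY NAME.
House style of the registered lines of this sub-problem (`#h21_check_skeleton`: no `Prop` hypotheses other than
registered obligations; the stubs are used by name inside the proof, so this theorem's only `sorryAx` dependence
is through `stub_borell_compact_of_tendsto` and `stub_borell_of_compact`; its own body is sorry-free).
[Eyink–Lebowitz–Spohn 1991 architecture; Borell 1975 Thm 2.1; Kipnis–Landim 1999] -/
theorem LogConcaveWindowLimit_of : LogConcaveWindowLimit := by
  intro ω₂ lam β γ T_L T_R μ hss hmom hlc ε hε hfreq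
  set P := pinnedChain ω₂ lam β γ with hP
  have hprob : ∀ N, IsProbabilityMeasure (μ N) := fun N => (hss N).1
  obtain ⟨B, hB⟩ := centre_current_lower_bound (T_L := T_L) (T_R := T_R) μ hss hmom
  have hfreq' : ∃ᶠ N in atTop, ε ≤ |P.totalCurrent (μ N) / ((N : ℝ) - 1)| ∧ 6 ≤ N :=
    hfreq.and_eventually (eventually_ge_atTop 6)
  obtain ⟨φ, hφmono, hφ⟩ := extraction_of_frequently_atTop hfreq'
  obtain ⟨ψ, ν, hν, hψmono, hlim⟩ := exists_weak_limit (T_L := T_L) (T_R := T_R) μ hss hmom φ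
  haveI := hν
  have hNk : Tendsto (fun k => φ (ψ k)) atTop atTop := hφmono.tendsto_atTop.comp hψmono.tendsto_atTop
  refine ⟨ν, hν, isTimeInvariant_window_limit μ hss hmom hNk hlim,
    moments_of_window_limit μ hprob hmom hlim, ?_, (current_of_window_limit (ω₂ := ω₂) (lam := lam) (β := β)
      (γ := γ) μ hprob hmom hNk hlim).1, ?_⟩
  · -- BORELL LOG-CONCAVITY OF EVERY BOX MARGINAL OF THE LIMIT: window laws → box marginal weakly (proved),
    -- S1 on compact pairs along that sequence (each window law is Borell by `hlc`), then S2.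
    intro a n
    obtain ⟨ρs, ρ, hρ, hconv, hρs⟩ := windowLaws_tendsto_boxMarginal μ hprob hNk hlim a n
    have hcpt : ∀ (A' B' : Set (Fin (n + 1) → ℝ × ℝ)) (θ : ℝ), IsCompact A' → IsCompact B' → 0 < θ → θ < 1 →
        (ρ : Measure (Fin (n + 1) → ℝ × ℝ)) A' ^ θ * (ρ : Measure (Fin (n + 1) → ℝ × ℝ)) B' ^ (1 - θ) ≤
          (ρ : Measure (Fin (n + 1) → ℝ × ℝ)) {z | ∃ x ∈ A', ∃ y ∈ B', z = θ • x + (1 - θ) • y} := by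
      refine stub_borell_compact_of_tendsto ρs ρ hconv fun k A' B' θ hA' hB' hθ hθ1 => ?_
      obtain ⟨N, a', h, hk⟩ := hρs k
      rw [hk]
      exact hlc N a' n h A' B' θ hA' hB' hθ hθ1
    intro A' B' θ hA' hB' hθ hθ1
    rw [← hρ]
    exact stub_borell_of_compact (ρ : Measure (Fin (n + 1) → ℝ × ℝ)) hcpt A' B' θ hA' hB' hθ hθ1
  · -- `ε ≤ |∫ j₀ dν|` from `(N-1) ε ≤ (N-3) |J_N| + B` along the subsequence (verbatim from the twin)
    have hcur : Tendsto (fun k => |centreCurrent P (μ (φ (ψ k)))|) atTop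
        (𝓝 |∫ σ, P.bondCurrentZ σ 0 ∂ν|) := (current_of_window_limit μ hprob hmom hNk hlim).2.abs
    have hN3 : Tendsto (fun k => ((φ (ψ k) : ℕ) : ℝ) - 3) atTop atTop :=
      tendsto_atTop_add_const_right _ _ (tendsto_natCast_atTop_atTop.comp hNk)
    have hlow : Tendsto (fun k => ε + (2 * ε - B) / (((φ (ψ k) : ℕ) : ℝ) - 3)) atTop (𝓝 ε) := by
      have h := (tendsto_const_nhds (x := 2 * ε - B)).div_atTop hN3
      simpa using (tendsto_const_nhds (x := ε)).add h
    refine le_of_tendsto_of_tendsto hlow hcur (Eventually.of_forall fun k => ?_)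
    obtain ⟨hεk, h6⟩ := hφ (ψ k)
    have hBk := hB (φ (ψ k)) h6
    set Nr : ℝ := ((φ (ψ k) : ℕ) : ℝ) with hNr
    have h6r : (6 : ℝ) ≤ Nr := by rw [hNr]; exact_mod_cast h6
    have hN1 : 0 < Nr - 1 := by linarith
    have hN3' : 0 < Nr - 3 := by linarith
    have h1 : (Nr - 1) * ε ≤ (Nr - 3) * |centreCurrent P (μ (φ (ψ k)))| + B :=
      (mul_le_mul_of_nonneg_left hεk hN1.le).trans hBk
    have h2 : ε + (2 * ε - B) / (Nr - 3) = ((Nr - 1) * ε - B) / (Nr - 3) := by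
      field_simp
      ring
    show ε + (2 * ε - B) / (Nr - 3) ≤ |centreCurrent P (μ (φ (ψ k)))|
    rw [h2, div_le_iff₀ hN3']
    linarith

end Summit.AtomisticToContinuum.FouriersLaw.Cruxes.LogConcaveWindowLimit.Birth

end
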